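import Mathlib.RepresentationTheory.Homological.GroupCohomology.LowDegree
import Literature.NumberTheory.GaloisRepresentations.ContinuousH1
import HarnessLib

/-!
# For a discrete group, Mathlib's `groupCohomology.H1` IS Mathlib's `continuousCohomology 1`

Topic `NumberTheory/GaloisRepresentations`; namespace `Literature.NumberTheory.GaloisRepresentations`.
Generic glue between the two first-cohomology groups Mathlib offers for a group `K` acting on a
module `M`:

* `groupCohomology.H1 (Rep.of ρ)` — homology of the INHOMOGENEOUS cochains of the `k`-linear
  representation `ρ : Representation k K M` (abstract group, no topology), with its cocycle API
  `cocycles₁`, `H1π`, `H1π_eq_zero_iff`, `H1_induction_on`;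
* `continuousCohomology 1 (TopRep.of π)` — homology of the continuous HOMOGENEOUS cochains of a
  continuous realisation `π : ContRepresentation k K M` of the same action on a topological module
  `M`, with the crossed-homomorphism API of `ContinuousH1.lean` (`contOneCocycles`,
  `oneCocycleClass`, `_surjective`, `_eq_zero_iff`).

When `K` carries the DISCRETE topology every crossed homomorphism `K → M` is continuous, and the
two groups coincide: `H1DiscreteEquiv ρ π hπ : groupCohomology.H1 (Rep.of ρ) ≃+ continuousCohomology 1
(TopRep.of π)`, characterised by `H1DiscreteEquiv_H1π : [x] ↦ oneCocycleClass x` (both are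
"crossed homomorphisms modulo principal crossed homomorphisms", Serre, *Galois Cohomology*, I §2.3
and I §5.1 [cite: SerreGaloisCohomology1997, I §2.3]; Neukirch–Schmidt–Wingberg (1.2), II §7
[cite: NeukirchSchmidtWingberg2008, I §2 and II §7]).

Written for the abc-iut cell, row L1-γ₁ (seat abc-iut-L2-t12): [FrdII] Def. 2.2 / 2.3 type the
Kummer classes in `groupCohomology.H1 (Rep.ofMulDistribMulAction H_A μ_N(A))` (the finite group
`H_A`) while condition (c) and `F_N(A)` live in `continuousCohomology` of the discrete `H_A`
(`Kummer.muTopRep`); the cup-product construction of the duality isomorphism needs this bridge.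
Everything is definitional / proved; no named facts.
-/

noncomputable section

open CategoryTheory groupCohomology

namespace Literature.NumberTheory.GaloisRepresentations

universe u

variable {k : Type u} [CommRing k] [TopologicalSpace k]
  {K : Type u} [Group K] [TopologicalSpace K] [DiscreteTopology K]
  {M : Type u} [AddCommGroup M] [Module k M] [TopologicalSpace M] [IsTopologicalAddGroup M]
  [ContinuousSMul k M]
  (ρ : Representation k K M) (π : ContRepresentation k K M) (hπ : ∀ g x, π g x = ρ g x)

/-! ### Cocycles: inhomogeneous `1`-cocycles are continuous crossed homomorphisms -/

/-- An inhomogeneous `1`-cocycle `f : K → M` of `Rep.of ρ` (`f (g h) = g • f h + f g`) is a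
continuous crossed homomorphism of `TopRep.of π` (`K` discrete). [cite: SerreGaloisCohomology1997, I §2.3] -/
def cocycles₁ToContOneCocycles : cocycles₁ (Rep.of ρ) →ₗ[k] contOneCocycles (TopRep.of π) where
  toFun f := ⟨⟨(f : K → M), continuous_of_discreteTopology⟩, fun g h => by
    change (f : K → M) (g * h) = (f : K → M) g + π g ((f : K → M) h)
    rw [(mem_cocycles₁_iff (A := Rep.of ρ) (f : K → M)).1 f.2 g h, hπ, add_comm]⟩
  map_add' f g := Subtype.ext (ContinuousMap.ext fun x => rfl)
  map_smul' c f := Subtype.ext (ContinuousMap.ext fun x => rfl)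

/-- `cocycles₁ToContOneCocycles f` is `f` as a function. [cite: SerreGaloisCohomology1997, I §2.3] -/
@[simp] theorem cocycles₁ToContOneCocycles_apply (f : cocycles₁ (Rep.of ρ)) (g : K) :
    (cocycles₁ToContOneCocycles ρ π hπ f).1 g = (f : K → M) g := rfl

/-- Conversely a continuous crossed homomorphism of `TopRep.of π` is an inhomogeneous `1`-cocycle of
`Rep.of ρ`. [cite: SerreGaloisCohomology1997, I §2.3] -/
def contOneCocyclesToCocycles₁ (c : contOneCocycles (TopRep.of π)) : cocycles₁ (Rep.of ρ) :=
  ⟨fun g => c.1 g, (mem_cocycles₁_iff (A := Rep.of ρ) _).2 fun g h => by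
    change c.1 (g * h) = ρ g (c.1 h) + c.1 g
    rw [c.2 g h, ← hπ, add_comm]⟩

/-- The two dictionaries are inverse to each other (one direction).
[cite: SerreGaloisCohomology1997, I §2.3] -/
@[simp] theorem cocycles₁ToContOneCocycles_contOneCocyclesToCocycles₁
    (c : contOneCocycles (TopRep.of π)) :
    cocycles₁ToContOneCocycles ρ π hπ (contOneCocyclesToCocycles₁ ρ π hπ c) = c :=
  Subtype.ext (ContinuousMap.ext fun _ => rfl)

/-! ### The class map on cocycles and its descent to `H¹` -/

variable [IsTopologicalGroup K]

/-- `f ↦ [f]_cont`: an inhomogeneous cocycle to the class of the corresponding crossed homomorphism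
in `continuousCohomology 1`. [cite: SerreGaloisCohomology1997, I §2.3] -/
def cocycles₁ToContinuousCohomology :
    cocycles₁ (Rep.of ρ) →ₗ[k] continuousCohomology 1 (TopRep.of π) :=
  (oneCocycleClassₗ (TopRep.of π)).comp (cocycles₁ToContOneCocycles ρ π hπ)

/-- Unfolding `cocycles₁ToContinuousCohomology`. [cite: SerreGaloisCohomology1997, I §2.3] -/
@[simp] theorem cocycles₁ToContinuousCohomology_apply (f : cocycles₁ (Rep.of ρ)) :
    cocycles₁ToContinuousCohomology ρ π hπ f =
      oneCocycleClass (TopRep.of π) (cocycles₁ToContOneCocycles ρ π hπ f) := rfl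

/-- A coboundary `g ↦ g • a - a` has zero class in `continuousCohomology 1` (it is a principal crossed
homomorphism). [cite: SerreGaloisCohomology1997, I §2.3] -/
theorem cocycles₁ToContinuousCohomology_eq_zero_of_mem (f : cocycles₁ (Rep.of ρ))
    (hf : (f : K → M) ∈ coboundaries₁ (Rep.of ρ)) :
    cocycles₁ToContinuousCohomology ρ π hπ f = 0 := by
  obtain ⟨a, ha⟩ := hf
  rw [cocycles₁ToContinuousCohomology_apply, oneCocycleClass_eq_zero_iff]
  refine ⟨a, fun g => ?_⟩
  rw [cocycles₁ToContOneCocycles_apply, ← ha]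
  change ρ g a - a = π g a - a
  rw [hπ]

/-- The explicit-quotient model `Z¹/B¹` of `H¹` that Mathlib exposes through `groupCohomology.H1Iso`
maps to `continuousCohomology 1`: the descent of `cocycles₁ToContinuousCohomology` to the quotient by
the coboundaries. [cite: SerreGaloisCohomology1997, I §2.3] -/
def quotientToContinuousCohomology :
    (shortComplexH1 (Rep.of ρ)).moduleCatLeftHomologyData.H →ₗ[k]
      continuousCohomology 1 (TopRep.of π) :=
  (LinearMap.range (shortComplexH1 (Rep.of ρ)).moduleCatToCycles).liftQ
    (cocycles₁ToContinuousCohomology ρ π hπ) (by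
      rintro f ⟨a, rfl⟩
      rw [LinearMap.mem_ker]
      apply cocycles₁ToContinuousCohomology_eq_zero_of_mem
      exact ⟨a, rfl⟩)

/-- **The comparison map** `H¹(K, Rep.of ρ) → H¹_cont(K, TopRep.of π)` (Mathlib inhomogeneous `H1` to
Mathlib continuous `H¹`), `K` discrete. [cite: SerreGaloisCohomology1997, I §2.3] -/
def H1ToContinuousCohomology : groupCohomology.H1 (Rep.of ρ) →ₗ[k] continuousCohomology 1 (TopRep.of π) :=
  (quotientToContinuousCohomology ρ π hπ).comp (H1Iso (Rep.of ρ)).hom.hom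

/-- **On classes of cocycles, the comparison map is `[f] ↦ [f]`.** [cite: SerreGaloisCohomology1997, I §2.3] -/
theorem H1ToContinuousCohomology_H1π (f : cocycles₁ (Rep.of ρ)) :
    H1ToContinuousCohomology ρ π hπ (H1π (Rep.of ρ) f) =
      oneCocycleClass (TopRep.of π) (cocycles₁ToContOneCocycles ρ π hπ f) := by
  have h1 : (H1Iso (Rep.of ρ)).hom (H1π (Rep.of ρ) f) =
      (shortComplexH1 (Rep.of ρ)).moduleCatLeftHomologyData.π f := by
    change (H1Iso (Rep.of ρ)).hom (groupCohomology.π (Rep.of ρ) 1 ((isoCocycles₁ (Rep.of ρ)).inv f)) = _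
    rw [π_comp_H1Iso_hom_apply, Iso.inv_hom_id_apply]
    rfl
  change quotientToContinuousCohomology ρ π hπ ((H1Iso (Rep.of ρ)).hom (H1π (Rep.of ρ) f)) = _
  rw [h1]
  rfl

/-- The comparison map is injective: a cocycle that is a principal CONTINUOUS crossed homomorphism
is a coboundary. [cite: SerreGaloisCohomology1997, I §2.3] -/
theorem H1ToContinuousCohomology_injective :
    Function.Injective (H1ToContinuousCohomology ρ π hπ) := by
  refine (injective_iff_map_eq_zero _).2 fun x hx => ?_
  induction x using H1_induction_on with
  | h f =>
    rw [H1ToContinuousCohomology_H1π, oneCocycleClass_eq_zero_iff] at hx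
    obtain ⟨a, ha⟩ := hx
    refine (H1π_eq_zero_iff f).2 ⟨a, funext fun g => ?_⟩
    have hg := ha g
    rw [cocycles₁ToContOneCocycles_apply] at hg
    rw [hg]
    change ρ g a - a = π g a - a
    rw [hπ]

/-- The comparison map is surjective: every continuous crossed homomorphism of the discrete `K` is
an inhomogeneous cocycle. [cite: SerreGaloisCohomology1997, I §2.3] -/
theorem H1ToContinuousCohomology_surjective :
    Function.Surjective (H1ToContinuousCohomology ρ π hπ) := by
  intro y
  obtain ⟨c, rfl⟩ := oneCocycleClass_surjective (TopRep.of π) y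
  refine ⟨H1π (Rep.of ρ) (contOneCocyclesToCocycles₁ ρ π hπ c), ?_⟩
  rw [H1ToContinuousCohomology_H1π, cocycles₁ToContOneCocycles_contOneCocyclesToCocycles₁]

/-- **`H¹(K, M) ≅ H¹_cont(K, M)` for a discrete group `K`** — Mathlib's inhomogeneous group cohomology
of `Rep.of ρ` and Mathlib's continuous cohomology of the continuous realisation `TopRep.of π` agree in
degree one, as `k`-modules. [cite: SerreGaloisCohomology1997, I §2.3] -/
def H1DiscreteEquiv : groupCohomology.H1 (Rep.of ρ) ≃ₗ[k] continuousCohomology 1 (TopRep.of π) :=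
  LinearEquiv.ofBijective (H1ToContinuousCohomology ρ π hπ)
    ⟨H1ToContinuousCohomology_injective ρ π hπ, H1ToContinuousCohomology_surjective ρ π hπ⟩

/-- `H1DiscreteEquiv` is the comparison map. [cite: SerreGaloisCohomology1997, I §2.3] -/
@[simp] theorem H1DiscreteEquiv_apply (x : groupCohomology.H1 (Rep.of ρ)) :
    H1DiscreteEquiv ρ π hπ x = H1ToContinuousCohomology ρ π hπ x := rfl

/-- `H1DiscreteEquiv [f] = [f]`. [cite: SerreGaloisCohomology1997, I §2.3] -/
theorem H1DiscreteEquiv_H1π (f : cocycles₁ (Rep.of ρ)) :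
    H1DiscreteEquiv ρ π hπ (H1π (Rep.of ρ) f) =
      oneCocycleClass (TopRep.of π) (cocycles₁ToContOneCocycles ρ π hπ f) :=
  H1ToContinuousCohomology_H1π ρ π hπ f

/-- The inverse sends the class of a continuous crossed homomorphism to the class of the same
cocycle. [cite: SerreGaloisCohomology1997, I §2.3] -/
theorem H1DiscreteEquiv_symm_oneCocycleClass (c : contOneCocycles (TopRep.of π)) :
    (H1DiscreteEquiv ρ π hπ).symm (oneCocycleClass (TopRep.of π) c) =
      H1π (Rep.of ρ) (contOneCocyclesToCocycles₁ ρ π hπ c) := by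
  apply (H1DiscreteEquiv ρ π hπ).injective
  rw [LinearEquiv.apply_symm_apply, H1DiscreteEquiv_H1π,
    cocycles₁ToContOneCocycles_contOneCocyclesToCocycles₁]

end Literature.NumberTheory.GaloisRepresentations
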